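import Literature.Probability.LatticeModels.RandomCurrentsProofs
import Literature.Probability.LatticeModels.IsingMonotonicity
import HarnessLib

/-!
# The random-current representation with `+` boundary condition

Trunk G02 (T-STATMECH), topic `Probability/LatticeModels`, namespace `Literature.StatMech`. Companion of
`RandomCurrents.lean` / `RandomCurrentsProofs.lean` (free boundary condition on the whole finite
graph, Duminil-Copin 2016, eq. (2.2)): here the **`+` boundary condition in a volume `Λ`** of a
finite graph `G`, in the ghost-free form of

* M. Aizenman, H. Duminil-Copin, V. Sidoravicius, *Random currents and continuity of Ising
  model's spontaneous magnetization*, Comm. Math. Phys. **334** (2015) 719–742, §2.1, eqs.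
  (2.7)–(2.8) (arXiv:1311.1937v3 numbering; bib key `AizenmanDuminilCopinSidoraviciusCMP2015`,
  "ADS15"),
* H. Duminil-Copin, *Lectures on the Ising and Potts models on the hypercubic lattice*,
  arXiv:1707.00520, §4.3, eq. (4.5) and the definition of `𝐏⁺_{G,β}` (sources prescribed only
  on the non-frozen vertices).

ADS15 (2.8) realise the `+` boundary condition by a ghost vertex `δ` with couplings
`J_{x,δ} = #{y ∉ Λ : y ∼ x}`; equivalently (module docstring of `DoubleCurrents.lean`) one keeps
the frozen boundary vertices, lets the current live on all edges of the finite graph `G` (assumed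
to touch `Λ`: `ℰ^b_Λ = E(G)`), and imposes the source constraint **only at the vertices of `Λ`**.
With `Z⁺_Λ(A) := ∑_{n : ∂n ∩ Λ = A} w_β(n)` (`plusCurrentSum`) the representation reads

* `∑_{τ ∈ {±1}^Λ} σ_A(τ ∨ +) ∏_{e ∈ E(G)} e^{β σ_e} = 2^{|Λ|} Z⁺_Λ(A)` for `A ⊆ Λ`
  (`sum_spinProduct_mul_prod_exp_glue_plus`, every real `β`),
* `Z⁺_{Λ;β,0} = 2^{|Λ|} Z⁺_Λ(∅)` and **`⟨σ_A⟩⁺_{Λ;β,0} = Z⁺_Λ(A) / Z⁺_Λ(∅)`**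
  (`isingPartitionFunction_plus_eq`, `isingCorr_plus_eq_plusCurrentSum_div`) whenever every edge
  of `G` touches `Λ` (`edgesTouching G Λ = G.edgeFinset`), for every real `β` and `A ⊆ Λ`.

The proof is the one of `RandomCurrentsProofs.lean` (expand `e^{βσ_e}` edge by edge, exchange the
finite sum over `τ` with the limit of the box partial sums over currents, and evaluate the vertex
sums `∑_{u=±1} u^{𝟙_A(x)+deg_n(x)}`), the only change being that a frozen vertex `x ∉ Λ` carries the
spin `+1` and contributes the factor `1` instead of `2·𝟙{even}` — whence the parity constraint at the
vertices of `Λ` only.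

## Mathlib status

No random currents in Mathlib. Anchors: `Fintype.prod_sum`, `Finset.prod_mul_prod_compl`,
`tendsto_finsetSum`, `tendsto_nhds_unique`, and the tree lemmas
`Current.sum_piFinset_weight_mul`, `tendsto_sum_piFinset_weight_mul_prod`,
`spinProduct_mul_prod_bondSpin_pow`, `sum_units_pow`, `Current.summable_weight_abs`
(`RandomCurrentsProofs.lean`).
-/

noncomputable section

open MeasureTheory Finset Filter Topology
open scoped symmDiff

namespace Literature.Probability.LatticeModels

variable {V : Type*} [Fintype V] [DecidableEq V] (G : SimpleGraph V) [DecidableRel G.Adj]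

/-! ### The generating sums with sources prescribed inside `Λ` -/

/-- The `+`-boundary-condition generating sum of the volume `Λ`:
`Z⁺_Λ(A) = ∑_{n : ∂n ∩ Λ = A} w_β(n)`, the sum of the weights of all currents on `E(G)` whose
sources **inside `Λ`** are exactly `A` (the parity of the `n`-degree at a frozen vertex `x ∉ Λ` is
free). This is the ghost-free form of ADS15's `∑_{n ∈ Ω_{Λ∪{δ}} : ∂n = A} w(n)` of (2.8) (the ghost
bond `{x,δ}` of coupling `J_{x,δ}` resolved into unit bonds to the frozen neighbours of `x`), and
Duminil-Copin 2017's `Z⁺` of (4.5). Written as a `tsum` of the indicator-restricted weights, like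
`currentSum`. [cite: AizenmanDuminilCopinSidoraviciusCMP2015, §2.1, eq. (2.8)] -/
def plusCurrentSum (Λ : Finset V) (β : ℝ) (A : Finset V) : ℝ :=
  ∑' n : Current G, if n.sources ∩ Λ = A then n.weight β else 0

/-- The indicator-restricted weights defining `plusCurrentSum` are summable (comparison with
`∑_n w_{|β|}(n) < ∞`, `Current.summable_weight_abs`). [cite: DuminilCopin2016, §2.1] -/
theorem summable_plusCurrentSum_term (Λ : Finset V) (β : ℝ) (A : Finset V) :
    Summable fun n : Current G => if n.sources ∩ Λ = A then n.weight β else 0 :=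
  (Current.summable_weight_abs G β).of_norm_bounded fun n => by
    split_ifs
    · rw [Real.norm_eq_abs, Current.abs_weight]
    · rw [norm_zero]; exact Current.weight_nonneg (abs_nonneg β) n

/-- `Z⁺_Λ(A) ≥ 0` for `β ≥ 0`. [cite: AizenmanDuminilCopinSidoraviciusCMP2015, §2.1, eq. (2.8)] -/
theorem plusCurrentSum_nonneg (Λ : Finset V) {β : ℝ} (hβ : 0 ≤ β) (A : Finset V) :
    0 ≤ plusCurrentSum G Λ β A :=
  tsum_nonneg fun n => by
    split_ifs
    · exact Current.weight_nonneg hβ n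
    · exact le_rfl

/-- On the whole vertex set the `+` generating sum is the free one:
`Z⁺_{univ}(A) = ∑_{∂n = A} w_β(n) = currentSum G β A`. [cite: DuminilCopin2016, §2.1, eq. (2.2)] -/
theorem plusCurrentSum_univ (β : ℝ) (A : Finset V) :
    plusCurrentSum G univ β A = currentSum G β A := by
  simp [plusCurrentSum, currentSum]

/-! ### The vertex sums with frozen `+` spins outside `Λ` -/

omit [Fintype V] [DecidableEq V] in
/-- `𝟙_p + k` is even iff (`p` holds exactly when `k` is odd). [folklore] -/
theorem even_ite_add_iff (p : Prop) [Decidable p] (k : ℕ) :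
    Even ((if p then 1 else 0) + k) ↔ (p ↔ Odd k) := by
  by_cases hp : p
  · rw [if_pos hp, add_comm, Nat.even_add_one, Nat.not_even_iff_odd]
    exact ⟨fun h => ⟨fun _ => h, fun _ => hp⟩, fun h => h.1 hp⟩
  · rw [if_neg hp, zero_add, ← Nat.not_odd_iff_even]
    exact ⟨fun h => ⟨fun h' => absurd h' hp, fun h' => absurd h' h⟩, fun h h' => hp (h.2 h')⟩

/-- The source constraint inside `Λ`: for `A ⊆ Λ`, `∂n ∩ Λ = A` iff every vertex `x ∈ Λ` has
`𝟙_A(x) + deg_n(x)` even. [cite: AizenmanDuminilCopinSidoraviciusCMP2015, §2.1, eq. (2.8)] -/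
theorem sources_inter_eq_iff {Λ A : Finset V} (hA : A ⊆ Λ) (n : Current G) :
    n.sources ∩ Λ = A ↔ ∀ x ∈ Λ, Even ((if x ∈ A then 1 else 0) + n.degree x) := by
  simp only [even_ite_add_iff]
  constructor
  · intro h x hx
    rw [← h, Finset.mem_inter, Current.mem_sources_iff]
    exact ⟨fun h' => h'.1, fun h' => ⟨h', hx⟩⟩
  · intro h
    ext x
    rw [Finset.mem_inter, Current.mem_sources_iff]
    constructor
    · rintro ⟨hodd, hx⟩
      exact (h x hx).2 hodd
    · intro hxA
      exact ⟨(h x (hA hxA)).1 hxA, hA hxA⟩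

/-- **The vertex sums with frozen boundary spins** (ADS15 (2.8) / Duminil-Copin 2017 (4.5),
derivation): for a current `n`, `A ⊆ Λ` and the configurations `τ ∨ +` (`τ ∈ {±1}^Λ` inside `Λ`,
`+1` outside),
`∑_τ σ_A(τ ∨ +) ∏_e σ_e(τ ∨ +)^{n_e} = 2^{|Λ|}` if `∂n ∩ Λ = A` and `0` otherwise: the frozen
vertices contribute `1^{deg} = 1`, the vertices of `Λ` contribute `∑_{u=±1} u^{𝟙_A + deg_n}`. [cite: AizenmanDuminilCopinSidoraviciusCMP2015, §2.1, eq. (2.8)] -/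
theorem sum_spinProduct_glue_plus_mul_prod_bondSpin_pow {Λ A : Finset V} (hA : A ⊆ Λ)
    (n : Current G) :
    ∑ τ : Λ → ℤˣ, spinProduct A (glue Λ τ .plus) *
        ∏ e : G.edgeFinset, bondSpin (glue Λ τ .plus) (e : Sym2 V) ^ n e =
      if n.sources ∩ Λ = A then (2 : ℝ) ^ #Λ else 0 := by
  set m : V → ℕ := fun x => (if x ∈ A then 1 else 0) + n.degree x with hm
  -- regroup by vertices and drop the frozen ones
  have h1 : ∀ τ : Λ → ℤˣ, spinProduct A (glue Λ τ .plus) *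
      ∏ e : G.edgeFinset, bondSpin (glue Λ τ .plus) (e : Sym2 V) ^ n e =
      ∏ x : Λ, (((τ x : ℤ) : ℝ)) ^ m x := by
    intro τ
    rw [spinProduct_mul_prod_bondSpin_pow G A n, ← Finset.prod_mul_prod_compl Λ]
    have hout : ∏ x ∈ Λᶜ, spinAt x (glue Λ τ .plus) ^ ((if x ∈ A then 1 else 0) + n.degree x) = 1 := by
      refine Finset.prod_eq_one fun x hx => ?_
      rw [Finset.mem_compl] at hx
      have : spinAt x (glue Λ τ .plus) = 1 := by
        rw [spinAt, glue_apply_of_notMem _ _ _ hx]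
        simp [BoundaryCondition.plus]
      rw [this, one_pow]
    rw [hout, mul_one, ← Finset.prod_coe_sort Λ]
    refine Finset.prod_congr rfl fun x _ => ?_
    rw [spinAt, glue_apply_of_mem _ _ _ x.2]
  simp_rw [h1]
  -- exchange sum and product
  have h2 : ∑ τ : Λ → ℤˣ, ∏ x : Λ, (((τ x : ℤ) : ℝ)) ^ m x =
      ∏ x : Λ, ∑ u : ℤˣ, (((u : ℤ) : ℝ)) ^ m x :=
    (Fintype.prod_sum fun (x : Λ) (u : ℤˣ) => (((u : ℤ) : ℝ)) ^ m x).symm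
  rw [h2]
  simp_rw [sum_units_pow]
  by_cases hs : n.sources ∩ Λ = A
  · rw [if_pos hs]
    have hall := (sources_inter_eq_iff G hA n).1 hs
    rw [Finset.prod_congr rfl fun (x : Λ) _ => if_pos (hall x x.2), Finset.prod_const,
      Finset.card_univ, Fintype.card_coe]
  · rw [if_neg hs]
    have hex : ∃ x : Λ, ¬Even (m x) := by
      by_contra hcon
      exact hs ((sources_inter_eq_iff G hA n).2 fun x hx => not_not.1 fun h => hcon ⟨⟨x, hx⟩, h⟩)
    obtain ⟨x, hx⟩ := hex
    exact Finset.prod_eq_zero (Finset.mem_univ x) (if_neg hx)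

/-! ### The representation -/

/-- **Random-current expansion with `+` boundary condition, numerators** (ADS15 §2.1, (2.8) in
the ghost-free form; Duminil-Copin 2017, (4.5)): for `A ⊆ Λ` and every real `β`,
`∑_{τ ∈ {±1}^Λ} σ_A(τ ∨ +) ∏_{e ∈ E(G)} e^{β σ_e(τ ∨ +)} = 2^{|Λ|} Z⁺_Λ(A)`. Both sides are the
limit of `∑_τ σ_A ∑_{n : n_e < N} w_β(n) ∏_e σ_e^{n_e}` as `N → ∞`. [cite: AizenmanDuminilCopinSidoraviciusCMP2015, §2.1, eq. (2.8)] -/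
theorem sum_spinProduct_mul_prod_exp_glue_plus {Λ A : Finset V} (hA : A ⊆ Λ) (β : ℝ) :
    ∑ τ : Λ → ℤˣ, spinProduct A (glue Λ τ .plus) *
        ∏ e : G.edgeFinset, Real.exp (β * bondSpin (glue Λ τ .plus) (e : Sym2 V)) =
      (2 : ℝ) ^ #Λ * plusCurrentSum G Λ β A := by
  have h1 : Tendsto (fun N : ℕ => ∑ τ : Λ → ℤˣ, spinProduct A (glue Λ τ .plus) *
      ∑ n ∈ Fintype.piFinset (fun _ : G.edgeFinset => range N),
        Current.weight β n * ∏ e : G.edgeFinset, bondSpin (glue Λ τ .plus) (e : Sym2 V) ^ n e)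
      atTop (𝓝 (∑ τ : Λ → ℤˣ, spinProduct A (glue Λ τ .plus) *
        ∏ e : G.edgeFinset, Real.exp (β * bondSpin (glue Λ τ .plus) (e : Sym2 V)))) :=
    tendsto_finsetSum _ fun τ _ => (tendsto_sum_piFinset_weight_mul_prod G β _).const_mul _
  have h2 : Tendsto (fun N : ℕ => ∑ τ : Λ → ℤˣ, spinProduct A (glue Λ τ .plus) *
      ∑ n ∈ Fintype.piFinset (fun _ : G.edgeFinset => range N),
        Current.weight β n * ∏ e : G.edgeFinset, bondSpin (glue Λ τ .plus) (e : Sym2 V) ^ n e)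
      atTop (𝓝 ((2 : ℝ) ^ #Λ * plusCurrentSum G Λ β A)) := by
    have hre : ∀ N : ℕ, ∑ τ : Λ → ℤˣ, spinProduct A (glue Λ τ .plus) *
        ∑ n ∈ Fintype.piFinset (fun _ : G.edgeFinset => range N),
          Current.weight β n * ∏ e : G.edgeFinset, bondSpin (glue Λ τ .plus) (e : Sym2 V) ^ n e =
        (2 : ℝ) ^ #Λ * ∑ n ∈ Fintype.piFinset (fun _ : G.edgeFinset => range N),
          (if Current.sources n ∩ Λ = A then Current.weight β n else 0) := by
      intro N
      simp_rw [Finset.mul_sum]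
      rw [Finset.sum_comm]
      refine Finset.sum_congr rfl fun n _ => ?_
      have h := sum_spinProduct_glue_plus_mul_prod_bondSpin_pow G hA n
      calc ∑ τ : Λ → ℤˣ, spinProduct A (glue Λ τ .plus) *
            (Current.weight β n * ∏ e : G.edgeFinset, bondSpin (glue Λ τ .plus) (e : Sym2 V) ^ n e)
          = Current.weight β n * ∑ τ : Λ → ℤˣ, spinProduct A (glue Λ τ .plus) *
              ∏ e : G.edgeFinset, bondSpin (glue Λ τ .plus) (e : Sym2 V) ^ n e := by
            rw [Finset.mul_sum]; exact Finset.sum_congr rfl fun τ _ => by ring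
        _ = (2 : ℝ) ^ #Λ * (if Current.sources n ∩ Λ = A then Current.weight β n else 0) := by
            rw [h]; split_ifs <;> ring
    simp_rw [hre]
    exact (tendsto_sum_piFinset_of_summable G (summable_plusCurrentSum_term G Λ β A)).const_mul _
  exact tendsto_nhds_unique h1 h2

/-- If every edge of `G` touches `Λ` (`ℰ^b_Λ = E(G)`), the `+` Boltzmann weight at zero field is
the product over all edges: `e^{-βℋ⁺_Λ(τ ∨ +)} = ∏_{e ∈ E(G)} e^{β σ_e(τ ∨ +)}`. [cite: AizenmanDuminilCopinSidoraviciusCMP2015, §2.1, eq. (2.8)] -/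
theorem isingWeight_plus_eq_prod_exp {Λ : Finset V} (hG : edgesTouching G Λ = G.edgeFinset)
    (β : ℝ) (τ : Λ → ℤˣ) :
    isingWeight G Λ β 0 .plus τ =
      ∏ e : G.edgeFinset, Real.exp (β * bondSpin (glue Λ τ .plus) (e : Sym2 V)) := by
  rw [isingWeight, isingHamiltonian, show (BoundaryCondition.plus : BoundaryCondition V) = .fixed 1
    from rfl, interactionEdges_fixed, hG, ← Real.exp_sum]
  congr 1
  rw [zero_mul, sub_zero, mul_neg, neg_mul, neg_neg, Finset.mul_sum, ← Finset.sum_coe_sort]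

/-- **Random-current expansion of the `+` partition function** (ADS15 §2.1, (2.8), ghost-free
form): if every edge of `G` touches `Λ`, then `Z⁺_{Λ;β,0} = 2^{|Λ|} ∑_{∂n ∩ Λ = ∅} w_β(n)` for every
real `β`. [cite: AizenmanDuminilCopinSidoraviciusCMP2015, §2.1, eq. (2.8)] -/
theorem isingPartitionFunction_plus_eq {Λ : Finset V} (hG : edgesTouching G Λ = G.edgeFinset)
    (β : ℝ) : isingPartitionFunction G Λ β 0 .plus = (2 : ℝ) ^ #Λ * plusCurrentSum G Λ β ∅ := by
  have h := sum_spinProduct_mul_prod_exp_glue_plus G (Finset.empty_subset Λ) β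
  have h1 : ∀ σ : SpinConfig V, spinProduct ∅ σ = 1 := fun σ => by simp [spinProduct]
  simp only [h1, one_mul] at h
  rw [isingPartitionFunction]
  simp_rw [isingWeight_plus_eq_prod_exp G hG β]
  exact h

/-- `Z⁺_Λ(∅) = 2^{-|Λ|} Z⁺_{Λ;β,0} > 0` for every real `β` (when every edge touches `Λ`). [cite: AizenmanDuminilCopinSidoraviciusCMP2015, §2.1, eq. (2.8)] -/
theorem plusCurrentSum_empty_pos {Λ : Finset V} (hG : edgesTouching G Λ = G.edgeFinset) (β : ℝ) :
    0 < plusCurrentSum G Λ β ∅ := by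
  have h := isingPartitionFunction_plus_eq G hG β
  have hZ := isingPartitionFunction_pos G Λ β 0 .plus
  have h2 : 0 < (2 : ℝ) ^ #Λ * plusCurrentSum G Λ β ∅ := lt_of_lt_of_eq hZ h
  exact pos_of_mul_pos_right h2 (by positivity)

/-- **Random-current representation of `+` correlations** (ADS15 §2.1, (2.7)–(2.8) in the
ghost-free form; Duminil-Copin 2017, (4.5)): if every edge of the finite graph `G` touches `Λ`,
then for every real `β` and every `A ⊆ Λ`,
`⟨σ_A⟩⁺_{Λ;β,0} = ∑_{∂n ∩ Λ = A} w_β(n) / ∑_{∂n ∩ Λ = ∅} w_β(n)`. [cite: AizenmanDuminilCopinSidoraviciusCMP2015, §2.1, eq. (2.8)] -/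
theorem isingCorr_plus_eq_plusCurrentSum_div {Λ : Finset V}
    (hG : edgesTouching G Λ = G.edgeFinset) (β : ℝ) {A : Finset V} (hA : A ⊆ Λ) :
    isingCorr G Λ β 0 .plus A = plusCurrentSum G Λ β A / plusCurrentSum G Λ β ∅ := by
  calc isingCorr G Λ β 0 .plus A
      = (∑ τ : Λ → ℤˣ, isingWeight G Λ β 0 .plus τ * spinProduct A (glue Λ τ .plus)) /
          isingPartitionFunction G Λ β 0 .plus :=
        integral_isingMeasure G Λ β 0 .plus (measurable_spinProduct A)
    _ = (2 : ℝ) ^ #Λ * plusCurrentSum G Λ β A / ((2 : ℝ) ^ #Λ * plusCurrentSum G Λ β ∅) := by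
        rw [isingPartitionFunction_plus_eq G hG β]
        congr 1
        simp_rw [isingWeight_plus_eq_prod_exp G hG β, mul_comm (∏ _e : G.edgeFinset, _)]
        exact sum_spinProduct_mul_prod_exp_glue_plus G hA β
    _ = plusCurrentSum G Λ β A / plusCurrentSum G Λ β ∅ := mul_div_mul_left _ _ (by positivity)

/-- **The free boundary condition as a special case**: if no edge of `G` leaves `Λ`
(`ℰ_Λ = ℰ^b_Λ`, e.g. when the vertices outside `Λ` are isolated), the free and the `+`
finite-volume Gibbs measures of `Λ` coincide (same interaction edges, same glued
configurations). [folklore] -/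
theorem isingMeasure_free_eq_plus_of_edgesIn_eq {Λ : Finset V}
    (hΛ : edgesIn G Λ = edgesTouching G Λ) (β h : ℝ) :
    isingMeasure G Λ β h .free = isingMeasure G Λ β h .plus := by
  have hg : (fun τ : Λ → ℤˣ => glue Λ τ .free) = fun τ => glue Λ τ .plus :=
    funext (glue_free_eq_glue_plus Λ)
  have hH : isingHamiltonian G Λ h .free = isingHamiltonian G Λ h .plus := by
    funext σ
    rw [isingHamiltonian, isingHamiltonian,
      show (BoundaryCondition.plus : BoundaryCondition V) = .fixed 1 from rfl,
      interactionEdges_free, interactionEdges_fixed, hΛ]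
  unfold isingMeasure isingRef
  rw [hg, hH]

/-- Under `ℰ_Λ = ℰ^b_Λ`, free and `+` expectations in `Λ` coincide. [folklore] -/
theorem isingExpect_free_eq_plus_of_edgesIn_eq {Λ : Finset V}
    (hΛ : edgesIn G Λ = edgesTouching G Λ) (β h : ℝ) (f : SpinConfig V → ℝ) :
    isingExpect G Λ β h .free f = isingExpect G Λ β h .plus f := by
  unfold isingExpect
  rw [isingMeasure_free_eq_plus_of_edgesIn_eq G hΛ]

end Literature.Probability.LatticeModels
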